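import Summits.Schanuel.Schanuel.Theorems.DiophantineDichotomyApproximationPropertyCycleAPIAt3Defs
import Literature.RingTheory.GradedAlgebra.IsolatedComponentRegularity
import HarnessLib

/-!
# `IsolatedPointClause3` from Chardin–Philippon's regularity of isolated points (crux `ApproximationProperty`, stmt-Schanuel-6117)

Crux `stmt-Schanuel-6117` (`Summit.Schanuel.Schanuel.Theses.DiophantineDichotomy.ApproximationProperty`),
route `DiophantineDichotomy`, line `orbit-interpolation-determinant`, lead c6
(`prover-line-stmt-Schanuel-6117-c6-0`, skeleton v16 `Cruxes/ApproximationProperty/Lines/orbit_interpolation_determinant.lean`).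

The intermediate statement `IsolatedPointClause3` of the stub plan (…CycleAPIAt3Defs.lean, p121319:
a rank-`1` homogeneous prime of `ℚ[x₀, …, x₃]` which is a minimal prime of `(Q, P, T)`, forms of
degrees `a, b, τ ∈ [1, δ₀]`, imposes independent conditions on the forms of every degree `ν` with
`3δ₀ ≤ ν + 2`) is the case `m = k = 3` of the Literature named fact
`Literature.RingTheory.GradedAlgebra.chardinPhilippon_isolatedInterpolation` (Chardin–Philippon,
J. Algebraic Geom. 8 (1999) 471–481, Théorème 1 + Corollaire 2(i); erratum 11 (2002) 599–600 does
not affect them; filed p131036): its threshold `a + b + τ + 1 ≤ ν + 3` follows from `3δ₀ ≤ ν + 2`.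
So the skeleton's stub `stub_isolatedPointClause3` is, from v16 on, LITERATURE DEBT: it is closed by
this glue (registered sub-goal `stub_isolatedPointClause3_of`) the moment
`chardinPhilippon_isolatedInterpolation_holds` lands.

Main result: `stub_isolatedPointClause3_of` (registered stub of the crux item, `--supports`).
-/

set_option linter.dupNamespace false

noncomputable section

open MvPolynomial

attribute [local instance] MvPolynomial.gradedAlgebra

namespace Summit.Schanuel.Schanuel.Cruxes.ApproximationProperty.OrbitInterpolationDeterminant

open Literature.NumberTheory.Transcendental.Nesterenko
open Literature.RingTheory.GradedAlgebra

/-- The ideal generated by the triple `![Q, P, T]` is `(Q) + (P) + (T)`. [folklore] -/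
theorem span_range_vecCons_three (Q P T : Rx 3) :
    Ideal.span (Set.range ![Q, P, T]) = Ideal.span {Q} ⊔ Ideal.span {P} ⊔ Ideal.span {T} := by
  rw [Matrix.range_cons, Matrix.range_cons, Matrix.range_cons, Matrix.range_empty,
    Set.union_empty]
  simp only [Set.singleton_union]
  rw [show ({Q, P, T} : Set (Rx 3)) = {Q} ∪ ({P} ∪ {T}) by rfl, Ideal.span_union,
    Ideal.span_union, sup_assoc]

/-- **Registered stub `stub_isolatedPointClause3_of`**: Chardin–Philippon's regularity of isolated
points (the Literature named fact `chardinPhilippon_isolatedInterpolation`, all `m`, all families of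
forms) gives `IsolatedPointClause3` (three forms of `ℚ[x₀, …, x₃]`, uniform degree bound `δ₀`, level
`3δ₀ − 2`): instantiate `m = k = 3`, `g = ![Q, P, T]`, `e = ![a, b, τ]`; the fact's threshold
`a + b + τ + 1 ≤ ν + 3` follows from `a, b, τ ≤ δ₀` and `3δ₀ ≤ ν + 2`.
[cite: ChardinPhilippon1999, Théorème 1 + Corollaire 2(i)] -/
theorem stub_isolatedPointClause3_of :
    chardinPhilippon_isolatedInterpolation → IsolatedPointClause3 := by
  intro h Q P T a b τ δ₀ hQ hP hT ha hb hτ haδ hbδ hτδ 𝔭 h𝔭p h𝔭h h𝔭u hmin ν hν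
  refine h 3 3 ![Q, P, T] ![a, b, τ] ?_ 𝔭 h𝔭p h𝔭h h𝔭u (span_range_vecCons_three Q P T ▸ hmin) ν ?_
  · intro j
    fin_cases j
    · exact ⟨hQ, ha⟩
    · exact ⟨hP, hb⟩
    · exact ⟨hT, hτ⟩
  · simp only [Fin.sum_univ_three, Matrix.cons_val_zero, Matrix.cons_val_one, Matrix.cons_val]
    omega

end Summit.Schanuel.Schanuel.Cruxes.ApproximationProperty.OrbitInterpolationDeterminant

end
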